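import Summits.ResolutionOfSingularities.ResolutionOfSingularities.Theorems.MarkedTransferCampaignW46MohWindowShadeStatement
import Summits.ResolutionOfSingularities.ResolutionOfSingularities.Theorems.MarkedTransferCampaignW46MohWindowShade
import Summits.ResolutionOfSingularities.ResolutionOfSingularities.Theorems.MarkedTransferCampaignW46MohWindowShadeCentres

/-!
# [OURS · L1 W4.6] Rung (iii) "Moh window" for the classical pair — the closers `…_holds`

Cell `res-hironaka`, rung L, slot W4.6, seat `res-L1-s46-pv-6`.  Each OURS predicate of
`MarkedTransferCampaignW46MohWindowShadeStatement.lean` is PROVED, by name, for every prime `p`, every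
field `K` of characteristic `p` and every finite set `σ` of residual variables, from the landed proofs
`MarkedTransferCampaignW46MohWindowShade.lean` (point blow-ups) and `…ShadeCentres.lean` (coordinate
centres).  No named fact, nothing of the manuscript [claim: Hironaka2017, status: under-review]; axioms
standard.  AI review is weaker than expert review.
-/

noncomputable section

set_option linter.dupNamespace false -- mandated namespace of this single-conjunct summit

namespace Summit.ResolutionOfSingularities.ResolutionOfSingularities.Theorems

open Literature.AlgebraicGeometry.Resolution

variable (p : ℕ) [Fact p.Prime] (K : Type*) [Field K] [DecidableEq K] [CharP K p]
variable (σ : Type*) [Fintype σ] [DecidableEq σ]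

/-- **[OURS · L1 W4.6] `CampaignW46MohWindowShadeNoKangaroo` holds**: no kangaroo point inside the
Moh window, every characteristic-`p` field, every dimension (closer; proof =
`CampaignW46.MohWindowShade.shade_step_le_of_window`).  NOT a statement of the manuscript. -/
theorem campaignW46MohWindowShadeNoKangaroo_holds : CampaignW46MohWindowShadeNoKangaroo p K σ := by
  intro j b hbj s hclean hlo hhi hr heq
  exact not_lt.mpr
    (CampaignW46.MohWindowShade.shade_step_le_of_window p j b hbj s hclean hlo hhi hr heq)

/-- **[OURS · L1 W4.6] `CampaignW46MohWindowShadeFrozen` holds**: at `ord₀ F = p` every equimultiple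
point is a stall (closer; proof = `CampaignW46.MohWindowShade.shadeStalls_of_ordZero_eq`).  NOT a
statement of the manuscript. -/
theorem campaignW46MohWindowShadeFrozen_holds : CampaignW46MohWindowShadeFrozen p K σ :=
  fun j b hbj s hclean hord hr heq =>
    CampaignW46.MohWindowShade.shadeStalls_of_ordZero_eq p j b hbj s hclean hord hr heq

/-- **[OURS · L1 W4.6] `CampaignW46MohWindowShadeCentreNoKangaroo` holds**: the same for
Moh-permissible coordinate centres of any dimension (closer; proof =
`CampaignW46.MohWindowShadeCentres.shade_step_le_of_window_centre`).  NOT a statement of the manuscript. -/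
theorem campaignW46MohWindowShadeCentreNoKangaroo_holds :
    CampaignW46MohWindowShadeCentreNoKangaroo p K σ :=
  fun _S _j hj b hbj hbN s hclean hhi hr hq hperm heq =>
    CampaignW46.MohWindowShadeCentres.shade_step_le_of_window_centre p hj b hbj hbN s hclean hhi hr hq
      hperm heq

/-- **[OURS · L1 W4.6] `CampaignW46MohWindowShadeAntitone` holds**: along equimultiple point blow-ups
staying in the window the shade is non-increasing (closer; proof =
`CampaignW46.MohWindowShade.shade_antitone_along_of_window`).  NOT a statement of the manuscript. -/
theorem campaignW46MohWindowShadeAntitone_holds : CampaignW46MohWindowShadeAntitone p K σ :=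
  fun s j b hb hstep hclean hr hord0 heq _N hwin _n _m hnm hmN =>
    CampaignW46.MohWindowShade.shade_antitone_along_of_window p s j b hb hstep hclean hr hord0 heq hwin
      hnm hmN

end Summit.ResolutionOfSingularities.ResolutionOfSingularities.Theorems
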